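import Mathlib
import HarnessLib
import Literature.NumberTheory.LFunctions.ZetaSubconvexity
import Literature.NumberTheory.LFunctions.CubicSumStructure
import Literature.NumberTheory.LFunctions.PartialSumsFourierCutoff
import Literature.NumberTheory.DiophantineApproximation.RationalsNearSeparatedPoints

/-!
# Bourgain's zeta sum `S = ∑_{M/2≤m≤M} e(T log(m/M))` cut into Huxley–Watt blocks: each block is a
# twisted incomplete cubic Gauss sum (PROVED)

Topic `Literature/NumberTheory/LFunctions`. First half of the Huxley–Watt reduction (3.4) of
J. Bourgain, *Decoupling, exponential sums and the Riemann zeta function*, J. AMS 30 (2017), §4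
("By following … the steps of §4 in [H-W] that precede Equation (4.8) there …"), rebuilt for
`F = log` from the held exposition S. W. Graham–G. Kolesnik, *Van der Corput's Method of Exponential
Sums* (LMS LN 126, 1991), §7.7, (7.7.1)–(7.7.5), with the Huxley–Watt choice of the rational:

1. **Blocks** (`norm_bourgainSum_le_blocks`): `‖S‖ ≤ ∑_{k<K} ‖∑_{L<n≤L+ℓ} e(T log((m_k+n)/M))‖ + ℓ`,
   `m_k = ⌈M/2⌉ - 1 + kℓ - L` (`blockStart`), `K = (⌊M⌋+1-⌈M/2⌉)/ℓ` (`blockCount`).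
2. **Taylor + Abel** (`norm_block_le`): `T log((m+n)/M) = T log(m/M) + θn + xn² + μn³ + E(n)` with
   `θ = T/m`, `x = -T/(2m²)`, `μ = T/(3m³)` (`log_block_phase_eq`), `|E'(y)| ≤ Ty³/m⁴`
   (`abs_logErr'_le`), so by the discrete Abel summation of `PartialSumsFourierCutoff.lean`
   `‖block‖ ≤ (1 + 2πT L₁³(L₁-L)/m⁴) max_{n₁} ‖∑_{L<n≤n₁} e(θn + xn² + μn³)‖`.
3. **The Huxley–Watt rational** (`leastDen`, `leastNum`, `qOf`, `aOf`): the least `q ≥ 1` with some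
   `|x - a/q| ≤ η = 1/(20R²)`; then `q ≤ 10R² + 1` (`qOf_le`), `(a, q) = 1` (`isUnit_aOf`), and `x`
   is `η`-far from every rational of denominator `< q` (`farFromRationals_qOf`, the input of the
   counting lemmas of `RationalsNearSeparatedPoints.lean`).
4. **Completing the cube** (`cubic_phase_eq`, `sum_e_cubic_eq_cubicSum`): with `β = x - a/q`,
   `s = β/(3μ)`, `b = round(q(θ - 3μs²))`, `λ = (q(θ-3μs²) - b)/q` (`|qλ| ≤ 1/2`,
   `abs_mul_twist_le`), `θn + xn² + μn³ = μ(n+s)³ + λn + (an²+bn)/q - μs³`, hence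
   `∑_{L<n≤n₁} e(θn + xn² + μn³) = e(-μs³) · cubicSum q a b μ s λ L n₁`
   (`Literature.NumberTheory.LFunctions.CubicSum.cubicSum` of `CubicSumStructure.lean`).

Result (`block_le_cubicSum`): every block of `S` is at most `(1 + 2πT L₁³ℓ/m⁴)` times
`‖cubicSum q a b μ s λ L n₁‖` for some `n₁ ∈ [L, L+ℓ]`, with the data
`(q, a, b, μ, s, λ) = (qOf, aOf, bOf, muOf, sOf, lamOf) T m R` satisfying `|s| ≤ m³/(20R²T)`
(`abs_sOf_le`), `|qλ| ≤ 1/2`, `(a, q) = 1`, `μ > 0` — i.e. the hypotheses of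
`CubicSum.cubicSum_structure` / `CubicSum.cubicSum_airy` once `L, ℓ, R` are chosen as in Bourgain's
§4 (`L ≍ N = MT^{-2/7}`, `R² ≍ M³/(NT)`), which is done downstream.

Everything is PROVED; no named fact is introduced.

## References

* J. Bourgain, *Decoupling, exponential sums and the Riemann zeta function*, J. Amer. Math. Soc. 30
  (2017), 205–224 — §4, (3.2)–(3.4). [BourgainJAMS2017]
* S. W. Graham, G. Kolesnik, *Van der Corput's Method of Exponential Sums*, LMS Lecture Note Series
  126, Cambridge Univ. Press 1991 — §7.7, (7.7.1)–(7.7.5); Lemma 7.2. [GrahamKolesnik1991]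
* M. N. Huxley, N. Watt, *Exponential sums and the Riemann zeta function*, Proc. London Math. Soc.
  (3) 57 (1988), 1–24 — §4, Steps 1–4. [HuxleyWatt1988]
-/

noncomputable section

open Real Complex Finset Set
open Literature.NumberTheory.LFunctions.PartialSums (norm_sum_Ioc_mul_le_abel sum_norm_sub_le_of_deriv)
open Literature.NumberTheory.LFunctions.CubicSum (cubicSum)
open Literature.NumberTheory.DiophantineApproximation (FarFromRationals exists_near_rational)

namespace Literature.NumberTheory.LFunctions
namespace LogSumBlocks

/-! ### Cutting a sum into blocks of equal length -/

/-- `∑_{a<m≤a+Kℓ} g(m) = ∑_{k<K} ∑_{a+kℓ<m≤a+(k+1)ℓ} g(m)`. [folklore] -/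
theorem sum_Ioc_eq_sum_blocks {M : Type*} [AddCommMonoid M] (g : ℕ → M) (a ℓ K : ℕ) :
    ∑ m ∈ Finset.Ioc a (a + K * ℓ), g m =
      ∑ k ∈ Finset.range K, ∑ m ∈ Finset.Ioc (a + k * ℓ) (a + (k + 1) * ℓ), g m := by
  induction K with
  | zero => simp
  | succ K ih =>
    rw [Finset.sum_range_succ, ← ih]
    exact (Finset.sum_Ioc_consecutive g (by nlinarith) (by nlinarith)).symm

/-- A block as a sum over `n ∈ (L, L + ℓ]` of `g(m₀ + n)`, `m₀ = a + kℓ - L` (`L ≤ a`). [folklore] -/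
theorem sum_block_eq_sum_shift {M : Type*} [AddCommMonoid M] (g : ℕ → M) {a L : ℕ} (hL : L ≤ a)
    (ℓ k : ℕ) :
    ∑ m ∈ Finset.Ioc (a + k * ℓ) (a + (k + 1) * ℓ), g m =
      ∑ n ∈ Finset.Ioc L (L + ℓ), g (a + k * ℓ - L + n) := by
  have key : Finset.Ioc (a + k * ℓ) (a + (k + 1) * ℓ) =
      (Finset.Ioc L (L + ℓ)).map (addLeftEmbedding (a + k * ℓ - L)) := by
    rw [Finset.map_add_left_Ioc, show (k + 1) * ℓ = k * ℓ + ℓ by ring]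
    congr 1 <;> omega
  rw [key, Finset.sum_map]
  rfl

/-- **Block decomposition with a short remainder:** for `g` bounded by `1` in modulus, `1 ≤ ℓ`,
`1 ≤ A`, `L ≤ A - 1` and `K = (B + 1 - A)/ℓ`,
`‖∑_{A≤m≤B} g(m)‖ ≤ ∑_{k<K} ‖∑_{L<n≤L+ℓ} g(A - 1 + kℓ - L + n)‖ + ℓ`. [folklore] -/
theorem norm_sum_Icc_le_blocks (g : ℕ → ℂ) (hg : ∀ m, ‖g m‖ ≤ 1) {A B ℓ L : ℕ} (hℓ : 1 ≤ ℓ)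
    (hA : 1 ≤ A) (hL : L ≤ A - 1) (hAB : A ≤ B + 1) :
    ‖∑ m ∈ Finset.Icc A B, g m‖ ≤
      ∑ k ∈ Finset.range ((B + 1 - A) / ℓ),
        ‖∑ n ∈ Finset.Ioc L (L + ℓ), g (A - 1 + k * ℓ - L + n)‖ + ℓ := by
  set K : ℕ := (B + 1 - A) / ℓ with hK
  set a : ℕ := A - 1 with ha
  have hKℓ : K * ℓ ≤ B + 1 - A := Nat.div_mul_le_self _ _
  have hmid : a ≤ a + K * ℓ := by omega
  have htop : a + K * ℓ ≤ B := by omega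
  have hIcc : Finset.Icc A B = Finset.Ioc a B := by
    ext m; simp only [Finset.mem_Icc, Finset.mem_Ioc]; omega
  rw [hIcc, ← Finset.sum_Ioc_consecutive g hmid htop, sum_Ioc_eq_sum_blocks g a ℓ K]
  refine (norm_add_le _ _).trans (add_le_add ?_ ?_)
  · refine (norm_sum_le _ _).trans (le_of_eq ?_)
    refine Finset.sum_congr rfl fun k _ => ?_
    rw [sum_block_eq_sum_shift g hL ℓ k]
  · -- the remainder has `< ℓ` terms
    calc ‖∑ m ∈ Finset.Ioc (a + K * ℓ) B, g m‖ ≤ ∑ m ∈ Finset.Ioc (a + K * ℓ) B, ‖g m‖ := norm_sum_le _ _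
      _ ≤ ∑ _m ∈ Finset.Ioc (a + K * ℓ) B, (1 : ℝ) := Finset.sum_le_sum fun m _ => hg m
      _ = ((B - (a + K * ℓ) : ℕ) : ℝ) := by rw [Finset.sum_const, Nat.card_Ioc, nsmul_eq_mul, mul_one]
      _ ≤ ℓ := by
          have : B - (a + K * ℓ) < ℓ := by
            have h1 : B + 1 - A - K * ℓ < ℓ := by
              rw [hK]
              have := Nat.lt_div_mul_add (a := B + 1 - A) (Nat.lt_of_lt_of_le Nat.zero_lt_one hℓ)
              -- `(B+1-A) < ((B+1-A)/ℓ) * ℓ + ℓ`... use mod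
              have h2 := Nat.mod_lt (B + 1 - A) (Nat.lt_of_lt_of_le Nat.zero_lt_one hℓ)
              have h3 := Nat.div_add_mod (B + 1 - A) ℓ
              rw [Nat.mul_comm] at h3
              omega
            omega
          exact_mod_cast this.le

/-! ### Application to `S = ∑_{M/2 ≤ m ≤ M} e(T log(m/M))` -/

/-- The block starts `m_k = ⌈M/2⌉ - 1 + kℓ - L`. [folklore] -/
def blockStart (M : ℝ) (ℓ L k : ℕ) : ℕ := ⌈M / 2⌉₊ - 1 + k * ℓ - L

/-- The number of blocks `K = (⌊M⌋ + 1 - ⌈M/2⌉)/ℓ`. [folklore] -/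
def blockCount (M : ℝ) (ℓ : ℕ) : ℕ := (⌊M⌋₊ + 1 - ⌈M / 2⌉₊) / ℓ

/-- **`S` cut into blocks:** for `1 ≤ ℓ`, `L + 1 ≤ ⌈M/2⌉`,
`‖S‖ ≤ ∑_{k<K} ‖∑_{L<n≤L+ℓ} e(T log((m_k + n)/M))‖ + ℓ`. [folklore] -/
theorem norm_bourgainSum_le_blocks (T M : ℝ) {ℓ L : ℕ} (hℓ : 1 ≤ ℓ) (hL : L + 1 ≤ ⌈M / 2⌉₊)
    (hM : ⌈M / 2⌉₊ ≤ ⌊M⌋₊ + 1) :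
    ‖bourgainSum Real.log T M‖ ≤
      ∑ k ∈ Finset.range (blockCount M ℓ),
        ‖∑ n ∈ Finset.Ioc L (L + ℓ),
          Complex.exp (2 * π * I * (T * Real.log (((blockStart M ℓ L k : ℝ) + n) / M) : ℝ))‖ + ℓ := by
  rw [bourgainSum]
  have h := norm_sum_Icc_le_blocks (fun m : ℕ => Complex.exp (2 * ↑π * I * ↑(T * Real.log ((m : ℝ) / M))))
    (fun m => by
      rw [show (2 * ↑π * I * ↑(T * Real.log ((m : ℝ) / M)) : ℂ) = ((2 * π * (T * Real.log ((m : ℝ) / M)) : ℝ) : ℂ) * I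
        by push_cast; ring, Complex.norm_exp_ofReal_mul_I])
    hℓ (by omega : 1 ≤ ⌈M / 2⌉₊) (by omega : L ≤ ⌈M / 2⌉₊ - 1) hM
  refine h.trans (le_of_eq ?_)
  congr 1
  refine Finset.sum_congr rfl fun k _ => ?_
  congr 1
  refine Finset.sum_congr rfl fun n _ => ?_
  simp only [blockStart]
  push_cast
  ring_nf

/-! ### Taylor expansion of `T log(1 + y/m)` to third order -/

/-- The quartic Taylor remainder `E(y) = T (log(1 + y/m) - y/m + (y/m)²/2 - (y/m)³/3)`. [folklore] -/
def logErr (T m y : ℝ) : ℝ := T * (Real.log (1 + y / m) - y / m + (y / m) ^ 2 / 2 - (y / m) ^ 3 / 3)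

/-- Its derivative `E'(y) = -T y³/(m³(m+y))`. [folklore] -/
def logErr' (T m y : ℝ) : ℝ := -T * y ^ 3 / (m ^ 3 * (m + y))

/-- `E` is differentiable with derivative `E'` (`y > -m`). [folklore] -/
theorem hasDerivAt_logErr {T m y : ℝ} (hm : 0 < m) (hy : -m < y) :
    HasDerivAt (logErr T m) (logErr' T m y) y := by
  have hmy : 0 < m + y := by linarith
  have hm0 : m ≠ 0 := hm.ne'
  have h1 : 0 < 1 + y / m := by
    rw [show 1 + y / m = (m + y) / m by field_simp]; positivity
  have hd : HasDerivAt (fun y : ℝ => y / m) (1 / m) y := by simpa using (hasDerivAt_id y).div_const m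
  have hlin : HasDerivAt (fun y : ℝ => 1 + y / m) (0 + 1 / m) y := (hasDerivAt_const y 1).add hd
  have hlog : HasDerivAt (fun y : ℝ => Real.log (1 + y / m)) ((0 + 1 / m) / (1 + y / m)) y :=
    hlin.log h1.ne'
  have hall := (((hlog.sub hd).add ((hd.pow 2).div_const 2)).sub ((hd.pow 3).div_const 3)).const_mul T
  refine (hall.congr_of_eventuallyEq ?_).congr_deriv ?_
  · exact Filter.Eventually.of_forall fun z => by
      simp only [logErr, Pi.add_apply, Pi.sub_apply, Pi.pow_apply]
  · rw [logErr']
    have h1' : 1 + y / m ≠ 0 := h1.ne'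
    have h2 : (1 + y / m) = (m + y) / m := by field_simp
    norm_num
    rw [h2]
    field_simp
    ring

/-- `|E'(y)| ≤ T y³/m⁴` for `0 ≤ y`, `0 < m`, `0 ≤ T`. [folklore] -/
theorem abs_logErr'_le {T m y : ℝ} (hT : 0 ≤ T) (hm : 0 < m) (hy : 0 ≤ y) :
    |logErr' T m y| ≤ T * y ^ 3 / m ^ 4 := by
  rw [logErr', abs_div, abs_mul, abs_neg, abs_of_nonneg hT, abs_of_nonneg (pow_nonneg hy 3),
    abs_of_pos (by positivity)]
  rw [div_le_div_iff₀ (by positivity) (by positivity)]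
  have : m ^ 4 ≤ m ^ 3 * (m + y) := by nlinarith [pow_pos hm 3]
  nlinarith [mul_nonneg hT (pow_nonneg hy 3)]

/-- `T log((m+n)/M) = T log(m/M) + (θn + xn² + μn³) + E(n)` with `θ = T/m`, `x = -T/(2m²)`,
`μ = T/(3m³)`. [folklore] -/
theorem log_block_phase_eq {T m M : ℝ} (hm : 0 < m) (hM : 0 < M) {n : ℝ} (hn : 0 ≤ n) :
    T * Real.log ((m + n) / M) =
      T * Real.log (m / M) + (T / m * n + (-(T / (2 * m ^ 2))) * n ^ 2 + T / (3 * m ^ 3) * n ^ 3)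
        + logErr T m n := by
  have h1 : (m + n) / M = (m / M) * (1 + n / m) := by field_simp
  rw [h1, Real.log_mul (by positivity) (by positivity), logErr]
  field_simp
  ring

/-- **One block after Taylor and Abel:** if every partial sum of the pure cubic phases is `≤ B`,
`‖∑_{L<n≤n₁} e(θn + xn² + μn³)‖ ≤ B` (`L ≤ n₁ ≤ L₁`), then
`‖∑_{L<n≤L₁} e(T log((m+n)/M))‖ ≤ (1 + 2π T L₁³ (L₁ - L)/m⁴) B`
(`0 < m`, `0 ≤ T`, `L₁ ≤ m`). [cite: GrahamKolesnik1991, §7.7 (Lemma 7.2 applied to `ω(n) = e(h_m(n))`)] -/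
theorem norm_block_le {T m M B : ℝ} (hT : 0 ≤ T) (hm : 0 < m) (hM : 0 < M) {L L₁ : ℕ} (hL : L ≤ L₁)
    (hB : ∀ n₁ ∈ Finset.Icc L L₁, ‖∑ n ∈ Finset.Ioc L n₁,
      Complex.exp (2 * π * I * (T / m * n + (-(T / (2 * m ^ 2))) * n ^ 2 + T / (3 * m ^ 3) * n ^ 3 : ℝ))‖ ≤ B) :
    ‖∑ n ∈ Finset.Ioc L L₁, Complex.exp (2 * π * I * (T * Real.log ((m + n) / M) : ℝ))‖ ≤
      (1 + 2 * π * T * (L₁ : ℝ) ^ 3 * ((L₁ : ℝ) - L) / m ^ 4) * B := by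
  have hB0 : 0 ≤ B := (norm_nonneg _).trans (hB L (Finset.mem_Icc.2 ⟨le_rfl, hL⟩))
  set a : ℕ → ℂ := fun n => Complex.exp (2 * π * I *
    (T / m * n + (-(T / (2 * m ^ 2))) * n ^ 2 + T / (3 * m ^ 3) * n ^ 3 : ℝ)) with ha
  set w : ℝ → ℂ := fun y => Complex.exp (2 * π * I * (logErr T m y : ℝ)) with hw
  -- factor out `e(f(m))` and split the phase
  have hterm : ∀ n : ℕ, Complex.exp (2 * π * I * (T * Real.log ((m + n) / M) : ℝ)) =
      Complex.exp (2 * π * I * (T * Real.log (m / M) : ℝ)) * (w n * a n) := by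
    intro n
    rw [log_block_phase_eq hm hM (Nat.cast_nonneg n), hw, ha]
    rw [← Complex.exp_add, ← Complex.exp_add]
    congr 1; push_cast; ring
  have hunit : ‖Complex.exp (2 * π * I * (T * Real.log (m / M) : ℝ))‖ = 1 := by
    rw [show (2 * π * I * (T * Real.log (m / M) : ℝ) : ℂ) = ((2 * π * (T * Real.log (m / M)) : ℝ) : ℂ) * I by
      push_cast; ring]
    exact Complex.norm_exp_ofReal_mul_I _
  rw [Finset.sum_congr rfl (fun n _ => hterm n), ← Finset.mul_sum, norm_mul, hunit, one_mul]
  -- Abel summation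
  have habel := norm_sum_Ioc_mul_le_abel a (fun n => w n) hL hB
  refine habel.trans (mul_le_mul_of_nonneg_right ?_ hB0)
  -- `‖w(L₁)‖ = 1` and the total variation
  have hwn : ∀ y : ℝ, ‖w y‖ = 1 := fun y => by
    simp only [hw]
    rw [show (2 * π * I * (logErr T m y : ℝ) : ℂ) = ((2 * π * logErr T m y : ℝ) : ℂ) * I by push_cast; ring]
    exact Complex.norm_exp_ofReal_mul_I _
  rw [hwn]
  gcongr
  -- derivative of `w`
  set D : ℝ := 2 * π * T * (L₁ : ℝ) ^ 3 / m ^ 4 with hD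
  have hD0 : 0 ≤ D := by positivity
  have hderiv : ∀ y ∈ Icc (L : ℝ) L₁, HasDerivWithinAt w (2 * π * I * (logErr' T m y : ℝ) * w y) (Icc (L : ℝ) L₁) y := by
    intro y hy
    have hy0 : 0 ≤ y := (Nat.cast_nonneg L).trans hy.1
    have hE := hasDerivAt_logErr (T := T) hm (by linarith : -m < y)
    have : HasDerivAt w (w y * (2 * π * I * (logErr' T m y : ℝ))) y :=
      (Complex.hasDerivAt_exp _).comp y ((hE.ofReal_comp).const_mul (2 * π * I))
    exact this.hasDerivWithinAt.congr_deriv (by ring)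
  have hbound : ∀ y ∈ Icc (L : ℝ) L₁, ‖2 * π * I * (logErr' T m y : ℝ) * w y‖ ≤ D := by
    intro y hy
    have hy0 : 0 ≤ y := (Nat.cast_nonneg L).trans hy.1
    rw [norm_mul, hwn, mul_one, show (2 * π * I * (logErr' T m y : ℝ) : ℂ) = ((2 * π * logErr' T m y : ℝ) : ℂ) * I by
      push_cast; ring, norm_mul, Complex.norm_I, mul_one, Complex.norm_real, Real.norm_eq_abs,
      abs_mul, abs_of_pos (by positivity : (0 : ℝ) < 2 * π)]
    have h1 := abs_logErr'_le hT hm hy0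
    have h2 : T * y ^ 3 / m ^ 4 ≤ T * (L₁ : ℝ) ^ 3 / m ^ 4 := by
      gcongr; exact hy.2
    rw [hD]
    have : 2 * π * (T * (L₁ : ℝ) ^ 3 / m ^ 4) = 2 * π * T * (L₁ : ℝ) ^ 3 / m ^ 4 := by ring
    rw [← this]
    exact mul_le_mul_of_nonneg_left (h1.trans h2) (by positivity)
  have htv := sum_norm_sub_le_of_deriv (f := w) hL hD0 hderiv hbound
  calc ∑ n ∈ Finset.Ico (L + 1) L₁, ‖w ((n + 1 : ℕ) : ℝ) - w n‖ ≤ ((L₁ : ℝ) - L) * D := by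
        convert htv using 2
    _ = 2 * π * T * (L₁ : ℝ) ^ 3 * ((L₁ : ℝ) - L) / m ^ 4 := by rw [hD]; ring

/-! ### Completing the cube and rounding the linear coefficient -/

/-- The shift `s = β/(3μ)`, `β = x - a/q`. [folklore] -/
def cubeShift (x μ : ℝ) (a : ℤ) (q : ℕ) : ℝ := (x - a / q) / (3 * μ)

/-- The integer linear coefficient `b = round(q θ')`, `θ' = θ - 3μs²`. [folklore] -/
def linCoeff (θ x μ : ℝ) (a : ℤ) (q : ℕ) : ℤ := round (q * (θ - 3 * μ * cubeShift x μ a q ^ 2))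

/-- The residual twist `λ = (qθ' - b)/q`, `|qλ| ≤ 1/2`. [folklore] -/
def twist (θ x μ : ℝ) (a : ℤ) (q : ℕ) : ℝ :=
  (q * (θ - 3 * μ * cubeShift x μ a q ^ 2) - linCoeff θ x μ a q) / q

/-- `|qλ| ≤ 1/2`. [folklore] -/
theorem abs_mul_twist_le (θ x μ : ℝ) (a : ℤ) {q : ℕ} (hq : q ≠ 0) :
    |q * twist θ x μ a q| ≤ 1 / 2 := by
  have hq' : (q : ℝ) ≠ 0 := by exact_mod_cast hq
  rw [twist, linCoeff, mul_div_cancel₀ _ hq']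
  exact abs_sub_round _

/-- **Completing the cube:** with `β = x - a/q`, `s = β/(3μ)`, `θ' = θ - 3μs²`, `b = round(qθ')`,
`λ = (qθ' - b)/q` one has, for every `n`,
`θn + xn² + μn³ = (μ(n+s)³ + λn) + (an² + bn)/q - μs³`. [folklore] -/
theorem cubic_phase_eq (θ x : ℝ) {μ : ℝ} (hμ : μ ≠ 0) (a : ℤ) {q : ℕ} (hq : q ≠ 0) (n : ℝ) :
    θ * n + x * n ^ 2 + μ * n ^ 3 =
      (μ * (n + cubeShift x μ a q) ^ 3 + twist θ x μ a q * n)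
        + (a * n ^ 2 + linCoeff θ x μ a q * n) / q - μ * cubeShift x μ a q ^ 3 := by
  have hq' : (q : ℝ) ≠ 0 := by exact_mod_cast hq
  rw [twist]
  set s := cubeShift x μ a q with hs
  set b := linCoeff θ x μ a q
  have hβ : x - a / q = 3 * μ * s := by rw [hs, cubeShift]; field_simp
  have hx : x = a / q + 3 * μ * s := by linarith
  rw [hx]
  field_simp
  ring

/-- The phase as a product: `e(θn + xn² + μn³) = e(-μs³) · e(μ(n+s)³ + λn) · ψ_q(an² + bn)`.
[folklore] -/
theorem e_cubic_phase_eq (θ x : ℝ) {μ : ℝ} (hμ : μ ≠ 0) (a : ℤ) {q : ℕ} [NeZero q] (n : ℕ) :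
    Complex.exp (2 * π * I * (θ * n + x * n ^ 2 + μ * n ^ 3 : ℝ)) =
      Complex.exp (2 * π * I * (-(μ * cubeShift x μ a q ^ 3) : ℝ)) *
        (Complex.exp (2 * π * I * (μ * (n + cubeShift x μ a q) ^ 3 + twist θ x μ a q * n : ℝ)) *
          (ZMod.stdAddChar ((a * n ^ 2 + linCoeff θ x μ a q * n : ℤ) : ZMod q) : ℂ)) := by
  have hq : q ≠ 0 := NeZero.ne q
  have hq' : (q : ℝ) ≠ 0 := by exact_mod_cast hq
  rw [ZMod.stdAddChar_coe, ← Complex.exp_add, ← Complex.exp_add]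
  congr 1
  have := cubic_phase_eq θ x hμ a hq n
  rw [this]
  push_cast
  field_simp
  ring

/-- **The block sum is a twisted cubic Gauss sum:**
`∑_{L<n≤n₁} e(θn + xn² + μn³) = e(-μs³) · cubicSum q a b μ s λ L n₁`. [folklore] -/
theorem sum_e_cubic_eq_cubicSum (θ x : ℝ) {μ : ℝ} (hμ : μ ≠ 0) (a : ℤ) {q : ℕ} [NeZero q] (L n₁ : ℕ) :
    ∑ n ∈ Finset.Ioc L n₁, Complex.exp (2 * π * I * (θ * n + x * n ^ 2 + μ * n ^ 3 : ℝ)) =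
      Complex.exp (2 * π * I * (-(μ * cubeShift x μ a q ^ 3) : ℝ)) *
        cubicSum q a (linCoeff θ x μ a q) μ (cubeShift x μ a q) (twist θ x μ a q) L n₁ := by
  rw [cubicSum, Nat.floor_natCast, Nat.floor_natCast, Finset.mul_sum]
  exact Finset.sum_congr rfl fun n _ => e_cubic_phase_eq θ x hμ a n

/-- `|s| = |β|/(3|μ|)`. [folklore] -/
theorem abs_cubeShift (x μ : ℝ) (a : ℤ) (q : ℕ) :
    |cubeShift x μ a q| = |x - a / q| / (3 * |μ|) := by
  rw [cubeShift, abs_div, abs_mul, abs_of_pos (by norm_num : (0 : ℝ) < 3)]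

/-! ### The rational approximation of least denominator in the window of radius `η` -/

section LeastDenominator

variable (x : ℝ) {η : ℝ}

/-- There is a denominator `q ≥ 1` with some `a/q` within `η` of `x`. [folklore] -/
theorem exists_denominator (hη : 0 < η) : ∃ q : ℕ, 0 < q ∧ ∃ a : ℤ, |x - a / q| ≤ η := by
  obtain ⟨q, hq0, _, a, ha⟩ := exists_near_rational x hη
  exact ⟨q, hq0, a, ha⟩

open Classical in
/-- `leastDen x η`: the least `q ≥ 1` such that some `a/q` lies within `η` of `x` (and `1` if
`η ≤ 0`). This is the denominator of the Huxley–Watt rational `a/q ∈ J(I)` attached to a block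
(Bourgain 2017, §4: "associated with a reduced rational `a/q ∈ J(I)`"). [cite: BourgainJAMS2017, §4 after (3.4)] -/
def leastDen (x η : ℝ) : ℕ := if h : 0 < η then Nat.find (exists_denominator x h) else 1

open Classical in
/-- `leastNum x η`: a numerator `a` with `|x - a/leastDen| ≤ η` (and `0` if `η ≤ 0`). [folklore] -/
def leastNum (x η : ℝ) : ℤ :=
  if h : 0 < η then Classical.choose (Nat.find_spec (exists_denominator x h)).2 else 0

open Classical in
/-- `leastDen ≥ 1`. [folklore] -/
theorem leastDen_pos : 0 < leastDen x η := by
  unfold leastDen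
  split_ifs with h
  · exact (Nat.find_spec (exists_denominator x h)).1
  · exact Nat.one_pos

/-- `leastDen` is never zero (instance, so that `ZMod (leastDen x η)` and `cubicSum` typecheck). [folklore] -/
instance neZero_leastDen : NeZero (leastDen x η) := ⟨(leastDen_pos x).ne'⟩

open Classical in
/-- The defining property of `leastNum`. [folklore] -/
theorem leastNum_spec (hη : 0 < η) : |x - leastNum x η / leastDen x η| ≤ η := by
  unfold leastNum leastDen
  rw [dif_pos hη, dif_pos hη]
  exact Classical.choose_spec (Nat.find_spec (exists_denominator x hη)).2

open Classical in
/-- Minimality: no smaller denominator works. [folklore] -/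
theorem leastDen_min (hη : 0 < η) {q : ℕ} (hq : 0 < q) (hlt : q < leastDen x η) (a : ℤ) :
    η < |x - a / q| := by
  unfold leastDen at hlt
  rw [dif_pos hη] at hlt
  have := Nat.find_min (exists_denominator x hη) hlt
  by_contra hc
  exact this ⟨hq, a, not_lt.1 hc⟩

/-- Hence `x` is `η`-far from all rationals of denominator `< leastDen`
(`Literature.NumberTheory.DiophantineApproximation.FarFromRationals`). [folklore] -/
theorem farFromRationals_leastDen (hη : 0 < η) : FarFromRationals η (leastDen x η) x :=
  fun _ hq hlt a => (leastDen_min x hη hq hlt a).le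

open Classical in
/-- `leastDen ≤ 1/(2η) + 1`. [folklore] -/
theorem leastDen_le (hη : 0 < η) : (leastDen x η : ℝ) ≤ 1 / (2 * η) + 1 := by
  obtain ⟨q, hq0, hqle, a, ha⟩ := exists_near_rational x hη
  have : leastDen x η ≤ q := by
    unfold leastDen; rw [dif_pos hη]
    exact Nat.find_min' (exists_denominator x hη) ⟨hq0, a, ha⟩
  exact le_trans (by exact_mod_cast this) hqle

/-- The least-denominator fraction is in lowest terms: `a` is a unit modulo `q`. [folklore] -/
theorem isUnit_leastNum (hη : 0 < η) :
    IsUnit ((leastNum x η : ℤ) : ZMod (leastDen x η)) := by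
  set q := leastDen x η with hqdef
  set a := leastNum x η with hadef
  have hq0 : 0 < q := leastDen_pos x
  rw [ZMod.coe_int_isUnit_iff_isCoprime, Int.isCoprime_iff_gcd_eq_one]
  by_contra hg
  -- `g = gcd(q, a) ≥ 2`; reduce the fraction
  set g : ℕ := Int.gcd (q : ℤ) a with hg'
  have hgpos : 0 < g := Int.gcd_pos_iff.2 (Or.inl (by exact_mod_cast hq0.ne'))
  have hg0 : g ≠ 0 := hgpos.ne'
  have hg2 : 2 ≤ g := (Nat.two_le_iff g).2 ⟨hg0, hg⟩
  have hga : (g : ℤ) ∣ a := Int.gcd_dvd_right ..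
  have hgq : (g : ℤ) ∣ (q : ℤ) := Int.gcd_dvd_left ..
  obtain ⟨a', ha'⟩ := hga
  obtain ⟨q'', hq''⟩ := hgq
  have hq''pos : 0 < q'' := by
    have : (0 : ℤ) < q := by exact_mod_cast hq0
    rw [hq''] at this
    have hg0' : (0 : ℤ) < g := by exact_mod_cast hgpos
    exact pos_of_mul_pos_right this hg0'.le
  set q' : ℕ := q''.toNat with hq'
  have hq'z : (q' : ℤ) = q'' := Int.toNat_of_nonneg hq''pos.le
  have hq'pos : 0 < q' := by omega
  have hq'lt : q' < q := by
    have : (q : ℤ) = g * q' := by rw [hq'z]; exact hq''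
    have h2 : (2 : ℤ) * q' ≤ g * q' := by
      have : (2 : ℤ) ≤ g := by exact_mod_cast hg2
      nlinarith
    omega
  have hfrac : (a : ℝ) / q = (a' : ℝ) / q' := by
    have hgR : (g : ℝ) ≠ 0 := by exact_mod_cast hg0
    have hq'R : (q' : ℝ) ≠ 0 := by exact_mod_cast hq'pos.ne'
    have h1 : (a : ℝ) = g * a' := by exact_mod_cast ha'
    have h2 : (q : ℝ) = g * q' := by
      have : (q : ℤ) = g * q' := by rw [hq'z]; exact hq''
      exact_mod_cast this
    rw [h1, h2]; field_simp
  have hclose : |x - a' / q'| ≤ η := by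
    have := leastNum_spec x hη
    rw [← hadef, ← hqdef, hfrac] at this
    exact this
  exact absurd hclose (not_le.2 (leastDen_min x hη hq'pos hq'lt a'))

end LeastDenominator

/-! ### The data of one block of `S = ∑ e(T log(m/M))` and its twisted cubic Gauss sum -/

section BlockData

/-- The window radius `η = 1/(20R²)`. [folklore] -/
def eta (R : ℕ) : ℝ := 1 / (20 * (R : ℝ) ^ 2)

/-- `η > 0` for `R ≥ 1`. [folklore] -/
theorem eta_pos {R : ℕ} (hR : 1 ≤ R) : 0 < eta R := by
  have : (1 : ℝ) ≤ R := by exact_mod_cast hR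
  unfold eta; positivity

/-- The Taylor coefficients of `f(u) = T log(u/M)` at `m`: `θ = f'(m) = T/m`, `x = f''(m)/2 = -T/(2m²)`,
`μ = f⁽³⁾(m)/6 = T/(3m³)`. [folklore] -/
def thetaOf (T m : ℝ) : ℝ := T / m

/-- `x = f''(m)/2 = -T/(2m²)` for `f(u) = T log(u/M)`. [folklore] -/
def xcoef (T m : ℝ) : ℝ := -(T / (2 * m ^ 2))

/-- `μ = f⁽³⁾(m)/6 = T/(3m³)` for `f(u) = T log(u/M)`. [folklore] -/
def muOf (T m : ℝ) : ℝ := T / (3 * m ^ 3)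

/-- The least denominator `q` of a rational within `η = 1/(20R²)` of `x = f''(m)/2`. [folklore] -/
abbrev qOf (T m : ℝ) (R : ℕ) : ℕ := leastDen (xcoef T m) (eta R)

/-- Its numerator `a`. [folklore] -/
def aOf (T m : ℝ) (R : ℕ) : ℤ := leastNum (xcoef T m) (eta R)

/-- The cube-completing shift `s = (x - a/q)/(3μ)`. [folklore] -/
def sOf (T m : ℝ) (R : ℕ) : ℝ := cubeShift (xcoef T m) (muOf T m) (aOf T m R) (qOf T m R)

/-- The integer linear coefficient `b = round(q(θ - 3μs²))`. [folklore] -/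
def bOf (T m : ℝ) (R : ℕ) : ℤ := linCoeff (thetaOf T m) (xcoef T m) (muOf T m) (aOf T m R) (qOf T m R)

/-- The residual twist `λ`, `|qλ| ≤ 1/2`. [folklore] -/
def lamOf (T m : ℝ) (R : ℕ) : ℝ := twist (thetaOf T m) (xcoef T m) (muOf T m) (aOf T m R) (qOf T m R)

variable {T M m : ℝ} {R : ℕ}

/-- `μ > 0`. [folklore] -/
theorem muOf_pos (hT : 0 < T) (hm : 0 < m) : 0 < muOf T m := by unfold muOf; positivity

/-- `q ≥ 1`. [folklore] -/
theorem qOf_pos : 0 < qOf T m R := leastDen_pos _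

/-- `q ≤ 10R² + 1`. [folklore] -/
theorem qOf_le (hR : 1 ≤ R) : (qOf T m R : ℝ) ≤ 10 * (R : ℝ) ^ 2 + 1 := by
  have h := leastDen_le (xcoef T m) (eta_pos hR)
  have hR' : (0 : ℝ) < R := by exact_mod_cast hR
  have : 1 / (2 * eta R) = 10 * (R : ℝ) ^ 2 := by unfold eta; field_simp; ring
  rw [this] at h
  exact h

/-- `|x - a/q| ≤ η`. [folklore] -/
theorem abs_xcoef_sub_le (hR : 1 ≤ R) : |xcoef T m - aOf T m R / qOf T m R| ≤ eta R :=
  leastNum_spec _ (eta_pos hR)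

/-- `x` is `η`-far from all rationals of denominator `< q`. [folklore] -/
theorem farFromRationals_qOf (hR : 1 ≤ R) : FarFromRationals (eta R) (qOf T m R) (xcoef T m) :=
  farFromRationals_leastDen _ (eta_pos hR)

/-- `(a, q) = 1`. [folklore] -/
theorem isUnit_aOf (hR : 1 ≤ R) : IsUnit ((aOf T m R : ℤ) : ZMod (qOf T m R)) :=
  isUnit_leastNum _ (eta_pos hR)

/-- `|qλ| ≤ 1/2`. [folklore] -/
theorem abs_q_mul_lamOf_le : |(qOf T m R : ℝ) * lamOf T m R| ≤ 1 / 2 :=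
  abs_mul_twist_le _ _ _ _ (qOf_pos (T := T) (m := m) (R := R)).ne'

/-- `|s| ≤ m³/(20R²T)` (`= η/(3μ)`). [folklore] -/
theorem abs_sOf_le (hT : 0 < T) (hm : 0 < m) (hR : 1 ≤ R) : |sOf T m R| ≤ m ^ 3 / (20 * (R : ℝ) ^ 2 * T) := by
  have hμ := muOf_pos hT hm
  have hR' : (0 : ℝ) < R := by exact_mod_cast hR
  rw [sOf, abs_cubeShift, abs_of_pos hμ, div_le_iff₀ (by positivity)]
  refine (abs_xcoef_sub_le hR).trans (le_of_eq ?_)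
  unfold eta muOf
  field_simp

/-- **One block of `S` is (up to a bounded factor) a twisted incomplete cubic Gauss sum.** For
`0 < T`, `0 < M`, `0 < m`: there is `n₁ ∈ [L, L + ℓ]` with
`‖∑_{L<n≤L+ℓ} e(T log((m+n)/M))‖ ≤ (1 + 2πT(L+ℓ)³ℓ/m⁴) ‖cubicSum q a b μ s λ L n₁‖`,
where `(q, a)` is the least-denominator rational within `1/(20R²)` of `f''(m)/2 = -T/(2m²)`,
`μ = T/(3m³)`, `s = (x - a/q)/(3μ)`, `b = round(q(f'(m) - 3μs²))`, `λ` the residual twist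
(`qOf, aOf, muOf, sOf, bOf, lamOf`). This is Steps 1–4 of [H-W] §4 / the first reductions of
G–K §7.7 ((7.7.1)–(7.7.5)) for `f = T log(u/M)`, made explicit.
[cite: GrahamKolesnik1991, §7.7 (7.7.1)–(7.7.5)] [cite: BourgainJAMS2017, §4 before (3.4)] -/
theorem block_le_cubicSum (hT : 0 < T) (hM : 0 < M) (hm : 0 < m) (R L ℓ : ℕ) :
    ∃ n₁ ∈ Finset.Icc L (L + ℓ),
      ‖∑ n ∈ Finset.Ioc L (L + ℓ), Complex.exp (2 * π * I * (T * Real.log ((m + n) / M) : ℝ))‖ ≤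
        (1 + 2 * π * T * ((L + ℓ : ℕ) : ℝ) ^ 3 * (((L + ℓ : ℕ) : ℝ) - L) / m ^ 4) *
          ‖cubicSum (qOf T m R) (aOf T m R) (bOf T m R) (muOf T m) (sOf T m R) (lamOf T m R) L n₁‖ := by
  classical
  set P : ℕ → ℝ := fun n₁ => ‖∑ n ∈ Finset.Ioc L n₁,
    Complex.exp (2 * π * I * (T / m * n + (-(T / (2 * m ^ 2))) * n ^ 2 + T / (3 * m ^ 3) * n ^ 3 : ℝ))‖ with hP
  obtain ⟨n₁, hn₁, hmax⟩ := Finset.exists_max_image (Finset.Icc L (L + ℓ)) P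
    ⟨L, Finset.mem_Icc.2 ⟨le_rfl, by omega⟩⟩
  refine ⟨n₁, hn₁, ?_⟩
  have hblock := norm_block_le (M := M) (B := P n₁) hT.le hm hM (by omega : L ≤ L + ℓ) hmax
  refine hblock.trans (le_of_eq ?_)
  congr 1
  -- identify the maximal partial sum with the cubic Gauss sum
  simp only [hP]
  have hμ : muOf T m ≠ 0 := (muOf_pos hT hm).ne'
  have key := sum_e_cubic_eq_cubicSum (thetaOf T m) (xcoef T m) hμ (aOf T m R) (q := qOf T m R) L n₁
  have hrw : ∀ n : ℕ, (T / m * n + (-(T / (2 * m ^ 2))) * n ^ 2 + T / (3 * m ^ 3) * n ^ 3 : ℝ) =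
      thetaOf T m * n + xcoef T m * n ^ 2 + muOf T m * n ^ 3 := fun n => by
    simp only [thetaOf, xcoef, muOf]
  simp_rw [hrw]
  rw [key, norm_mul, show (2 * π * I * (-(muOf T m * cubeShift (xcoef T m) (muOf T m) (aOf T m R) (qOf T m R) ^ 3) : ℝ) : ℂ)
      = ((2 * π * (-(muOf T m * cubeShift (xcoef T m) (muOf T m) (aOf T m R) (qOf T m R) ^ 3)) : ℝ) : ℂ) * I by
        push_cast; ring, Complex.norm_exp_ofReal_mul_I, one_mul]
  rfl

end BlockData

end LogSumBlocks
end Literature.NumberTheory.LFunctions
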